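/-
Origin: expansion seat `planner-pub-hodgecm-mc-period-1-g13-0`, handover #P43a 2026-08-20T06:41Z md5 c5ffde9ed009 (339 l., 36 decls; NEW additive leaf; imports Model.ArchSideOf (RUN 38) only; RUN 43; drop-alone, rowdeps ∅; cert mc/pub-hodgecm-mc-period-1-g13/certs/: compile over the RUN-42 GO #2 PKG .lake (symlink farm) rc 0 / 394 s / 0 errors / 0 warnings (compile-ArchSideOfTwist-c5ffde9ed009.log, empty), #print axioms 36/36 ⊆ {propext, Classical.choice, Quot.sound} (ax-ArchSideOfTwist-c5ffde9ed009.log 6a1faa36c8aa); NAME LIST (3 theorems): HodgeCM.Model.ArchSideTerm.hasThetaMajorants_lineRepT · HodgeCM.Model.ArchSideTerm.lineRepT_mem_thetaStabilizerEnd · HodgeCM.Model.ArchSideTerm.op_archSideOfT (alternates etaT_torus01 · etaT₁_apply_mk_one)) (`HOME/mc/pub-hodgecm-mc-period-1-g13/stage43/HodgeCM/Model/ArchSideOfTwist.lean`, md5 c5ffde9ed009, 339 lines);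
landed by the gen-16 packager (p-g16) in gate run 43 as `HodgeCM/Model/ArchSideOfTwist.lean` (verbatim).
-/
/-
HodgeCM/Model/ArchSideOfTwist.lean — period-1 lane (gen 13), the S pin TERM with a ν-TWISTED η-split on lines 0,1 (carch-1-g3's repair
(R1) of the LOCATED JUNCTION «row 12 `C`, line k = 1», STATUS 2026-08-20T06:09:56Z): for ONE extra datum `ν : CMAdelic L (frameD V) →* ℂˣ`
(a character of `U(V)(𝔸)`, continuous, trivial on `U(V)(L⁺)` — the shape of the W pin's `hηc`/`hη`),

  `etaT₀ V S η ν := (ν⁻¹ ∘ fst) · eta₀ V S η`   — `η₀'(v,u) = ν(v)⁻¹ · η(v, diag(u,1))`,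
  `etaT₁ V S η ν := (ν ∘ fst) · eta₁ V S η`     — `η₁'(v,u) = ν(v) · η(1, diag(1,u))`,

lines 2,3 keep the DEFAULT split `eta₂/eta₃` of `HodgeCM/Model/ArchSideOf.lean` verbatim.  Since `ν` cancels, the splitting identity of
LAYER B (`hη01`) still holds ON THE NOSE (`etaT_torus01`), so every see-saw junction of `HodgeCM/Model/ArchSideTerm.lean` re-instantiates
unchanged; the new line-1 datum is `etaT₁ V S η ν (x, 1) = ν x` (`etaT₁_apply_mk_one`; the default split has `eta₁ V S η (x, 1) = 1`), and the
default split is recovered at `ν = 1` (`etaT₀_one`, `etaT₁_one`).  The term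

  `archSideOfT V c hGR hGR₀ hGR₁ hGR₂ hGR₃ η hη hηc ν hν hνc h₁W A : ThetaAdelicSide V c`

is `archSideOf` with `(P k).ω := lineRepT … k := lineRepOf … (etaT₀ …) (etaT₁ …) (eta₂ …) (eta₃ …) k` (so `(P 2).ω`, `(P 3).ω` are
DEFINITIONALLY those of `archSideOf`), both Weil hypotheses PROVED from the same four framed tree facts
[Weil1964 III n°41 Thm 6 p. 193; GelbartRogawski1991 §3.1 Remark p. 457 L4–13] with the continuity of `η, ν` (`hηc`, `hνc`) and their
triviality on rational points (`hη`, `hν`), the archimedean component / away-factor / level companions of #1097 / `ArchSideLevel` verbatim,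
and the archimedean test data `A k : ArchLineInput V (lineRepT … k)` as input (as in `archSideOf`).  ADDITIVE leaf: imports
`HodgeCM.Model.ArchSideOf` only; no existing declaration is touched; no records, no cited facts, no E-binder, no placeholders.

Binders of `archSideOfT`, all told: the W pin's `hGR η hη hηc`, the four small-pair splittings `hGR₀ … hGR₃` [GR91 Prop. 3.1.1 p. 455],
the twist `ν` with `hν : ∀ γU ∈ CMRat L (frameD V), ν γU = 1` and `hνc : Continuous ↑ν`, `h₁W`, and `A`.

Origin: Hodge-CM model-construction cell, row `S` of BINDER-OWNERS (period-1), repair (R1) of carch-1-g3 (row 12 `C`); mathematics =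
[Howe1979 §3; Kudla1984 §1; GelbartRogawski1991 §3.1 pp. 455/457; Weil1964 III n°41] as reproduced in the tree files.
-/
import Summits.HodgeConjecture.HodgeCM.Model.ArchSideOf_2

set_option autoImplicit false

noncomputable section

open scoped Matrix SchwartzMap
open NumberField NumberField.mixedEmbedding
open Literature.NumberTheory.Automorphic Literature.NumberTheory.Weil1964
open Literature.NumberTheory.GelbartRogawski1991.UnitaryDualPair
open HodgeCM.Adelic HodgeCM.PerL34
open Literature.Geometry.ComplexHyperbolic.BallModel (U21)

namespace HodgeCM.Model

namespace ArchSideTerm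

variable {L : CMField} {ι₁ : L →+* ℂ} (V : HermSpace3 L ι₁) (S : StubTree.SeesawDatum L)

/-! ## §T The ν-twisted η-split of lines 0,1 and its identities -/

section Split

variable (η : CMAdelic (L : Type) (frameD V) × CMAdelic (L : Type) (dW S) →* ℂˣ) (ν : CMAdelic (L : Type) (frameD V) →* ℂˣ)

/-- `η₀' := (ν⁻¹ ∘ fst) · η₀` — `η₀'(v,u) = ν(v)⁻¹ · η(v, diag(u,1))`. -/
def etaT₀ : CMAdelic (L : Type) (frameD V) × CMAdelicOne (L : Type) →* ℂˣ :=
  ν⁻¹.comp (MonoidHom.fst _ _) * eta₀ V S η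

/-- `η₁' := (ν ∘ fst) · η₁` — `η₁'(v,u) = ν(v) · η(1, diag(1,u))`: line 1 now carries the `U(V)`-datum `ν`. -/
def etaT₁ : CMAdelic (L : Type) (frameD V) × CMAdelicOne (L : Type) →* ℂˣ :=
  ν.comp (MonoidHom.fst _ _) * eta₁ V S η

/-- (Ported verbatim from the HodgeCMPerL package; no docstring in the source.) -/
theorem etaT₀_def : etaT₀ V S η ν = ν⁻¹.comp (MonoidHom.fst _ _) * eta₀ V S η := rfl

/-- (Ported verbatim from the HodgeCMPerL package; no docstring in the source.) -/
theorem etaT₁_def : etaT₁ V S η ν = ν.comp (MonoidHom.fst _ _) * eta₁ V S η := rfl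

/-- (Ported verbatim from the HodgeCMPerL package; no docstring in the source.) -/
theorem etaT₀_apply (p : CMAdelic (L : Type) (frameD V) × CMAdelicOne (L : Type)) :
    etaT₀ V S η ν p = (ν p.1)⁻¹ * eta₀ V S η p := rfl

/-- (Ported verbatim from the HodgeCMPerL package; no docstring in the source.) -/
theorem etaT₁_apply (p : CMAdelic (L : Type) (frameD V) × CMAdelicOne (L : Type)) :
    etaT₁ V S η ν p = ν p.1 * eta₁ V S η p := rfl

/-- LAYER B's `hη01` for the twisted split: `ν` cancels against `ν⁻¹` (tree `cmEta_torus` via `eta_torus01`). -/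
theorem etaT_torus01 (v : CMAdelic (L : Type) (frameD V)) (u₀ u₁ : CMAdelicOne (L : Type)) :
    η (v, cmPlaneTorus (L : Type) (dW S) (u₀, u₁)) = etaT₀ V S η ν (v, u₀) * etaT₁ V S η ν (v, u₁) := by
  rw [etaT₀_apply, etaT₁_apply, mul_mul_mul_comm, inv_mul_cancel, one_mul, eta_torus01]

/-- **the line-1 `U(V)`-datum of the twisted split**: `η₁'(x, 1) = ν(x)` (the default split has `η₁(x, 1) = η(1, diag(1,1)) = 1`,
carch-1's `HodgeCM.Model.eta₁_apply_mk_one` of `ArchKTypeOfLineOne`; not redeclared here). -/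
theorem etaT₁_apply_mk_one (x : CMAdelic (L : Type) (frameD V)) : etaT₁ V S η ν (x, 1) = ν x := by
  rw [etaT₁_apply]
  change ν x * cmEta₁ (L : Type) (frameD V) (dW S) η 1 = ν x
  rw [map_one, mul_one]

/-- on `U(V) × 1` the twisted first-line character is `ν(x)⁻¹ · η(x, 1)`. -/
theorem etaT₀_apply_mk_one (x : CMAdelic (L : Type) (frameD V)) : etaT₀ V S η ν (x, 1) = (ν x)⁻¹ * η (x, 1) := by
  rw [etaT₀_apply]
  change (ν x)⁻¹ * η (x, cmPlaneTorusInl (L : Type) (dW S) 1) = _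
  rw [map_one]

/-- the default split is the case `ν = 1`. -/
theorem etaT₀_one : etaT₀ V S η 1 = eta₀ V S η := by
  ext p
  rw [etaT₀_apply, MonoidHom.one_apply, inv_one, one_mul]

/-- (Ported verbatim from the HodgeCMPerL package; no docstring in the source.) -/
theorem etaT₁_one : etaT₁ V S η 1 = eta₁ V S η := by
  ext p
  rw [etaT₁_apply, MonoidHom.one_apply, one_mul]

/-- continuity of `↑η₀'` from that of `↑η` (the W pin's `hηc`) and of `↑ν`. -/
theorem continuous_etaT₀ (hηc : Continuous fun p => ((η p : ℂˣ) : ℂ)) (hνc : Continuous fun v => ((ν v : ℂˣ) : ℂ)) :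
    Continuous fun p => ((etaT₀ V S η ν p : ℂˣ) : ℂ) := by
  have h : (fun p => ((etaT₀ V S η ν p : ℂˣ) : ℂ)) =
      fun p => (((ν p.1 : ℂˣ) : ℂ))⁻¹ * ((eta₀ V S η p : ℂˣ) : ℂ) := by
    funext p
    rw [etaT₀_apply, Units.val_mul, Units.val_inv_eq_inv_val]
  rw [h]
  exact ((hνc.comp continuous_fst).inv₀ fun p => (ν p.1).ne_zero).mul
    (continuous_cmEta₀ (L : Type) (frameD V) (dW S) η hηc)

/-- continuity of `↑η₁'` from that of `↑η` and of `↑ν`. -/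
theorem continuous_etaT₁ (hηc : Continuous fun p => ((η p : ℂˣ) : ℂ)) (hνc : Continuous fun v => ((ν v : ℂˣ) : ℂ)) :
    Continuous fun p => ((etaT₁ V S η ν p : ℂˣ) : ℂ) := by
  have h : (fun p => ((etaT₁ V S η ν p : ℂˣ) : ℂ)) =
      fun p => ((ν p.1 : ℂˣ) : ℂ) * ((eta₁ V S η p : ℂˣ) : ℂ) := by
    funext p
    rw [etaT₁_apply, Units.val_mul]
  rw [h]
  exact (hνc.comp continuous_fst).mul (continuous_cmEta₁_comp_snd (L : Type) (frameD V) (dW S) η hηc)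

/-- `η₀'` is trivial at rational points when `η` (the W pin's `hη`) and `ν` are. [GelbartRogawski1991 §3.1 Remark p. 457 L4–13] -/
theorem etaT₀_eq_one_of_rat (hη : ∀ γU ∈ CMRat (L : Type) (frameD V), ∀ γ ∈ CMRat (L : Type) (dW S), η (γU, γ) = 1)
    (hν : ∀ γU ∈ CMRat (L : Type) (frameD V), ν γU = 1) {v : CMAdelic (L : Type) (frameD V)} (hv : v ∈ CMRat (L : Type) (frameD V))
    {t : ↥(Literature.NumberTheory.Automorphic.relNormOneIdeles (↥(maximalRealSubfield L)) L)}
    (ht : t ∈ Literature.NumberTheory.Automorphic.relNormOneRat (↥(maximalRealSubfield L)) L) :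
    etaT₀ V S η ν (v, (UnitaryGroup.cmAdelicOneEquivRelNormOne (L : Type)).symm t) = 1 := by
  rw [etaT₀_apply, hν v hv, inv_one, one_mul]
  exact cmEta₀_eq_one_of_rat (L : Type) (frameD V) (dW S) η hη hv ht

/-- `η₁'` is trivial at rational points when `η` and `ν` are. [GelbartRogawski1991 §3.1 Remark p. 457 L4–13] -/
theorem etaT₁_eq_one_of_rat (hη : ∀ γU ∈ CMRat (L : Type) (frameD V), ∀ γ ∈ CMRat (L : Type) (dW S), η (γU, γ) = 1)
    (hν : ∀ γU ∈ CMRat (L : Type) (frameD V), ν γU = 1) {v : CMAdelic (L : Type) (frameD V)} (hv : v ∈ CMRat (L : Type) (frameD V))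
    {t : ↥(Literature.NumberTheory.Automorphic.relNormOneIdeles (↥(maximalRealSubfield L)) L)}
    (ht : t ∈ Literature.NumberTheory.Automorphic.relNormOneRat (↥(maximalRealSubfield L)) L) :
    etaT₁ V S η ν (v, (UnitaryGroup.cmAdelicOneEquivRelNormOne (L : Type)).symm t) = 1 := by
  rw [etaT₁_apply, hν v hv, one_mul]
  exact cmEta₁_eq_one_of_rat (L : Type) (frameD V) (dW S) η hη ht

end Split

/-! ## §W The twisted line representations and their two Weil hypotheses, PROVED -/

section Weil

variable
  (hGR : (cmSplittingDatum (L : Type) finProdFinEquiv (frameD V) (frameD_real V) (frameD_ne V) (dW S) (dW_real S) (dW_ne S)).CompatibleSplitting)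
  (hGR₀ : (cmSplittingDatum (L : Type) (e₁) (frameD V) (frameD_real V) (frameD_ne V) (lineVec (L : Type) (dW S 0))
    (fun _ => dW_real S 0) (fun _ => dW_ne S 0)).CompatibleSplitting)
  (hGR₁ : (cmSplittingDatum (L : Type) (e₁) (frameD V) (frameD_real V) (frameD_ne V) (lineVec (L : Type) (dW S 1))
    (fun _ => dW_real S 1) (fun _ => dW_ne S 1)).CompatibleSplitting)
  (hGR₂ : (cmSplittingDatum (L : Type) (e₁) (frameD V) (frameD_real V) (frameD_ne V) (lineVec (L : Type) (dW' S 0))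
    (fun _ => dW'_real S 0) (fun _ => dW'_ne S 0)).CompatibleSplitting)
  (hGR₃ : (cmSplittingDatum (L : Type) (e₁) (frameD V) (frameD_real V) (frameD_ne V) (lineVec (L : Type) (dW' S 1))
    (fun _ => dW'_real S 1) (fun _ => dW'_ne S 1)).CompatibleSplitting)
  (η : CMAdelic (L : Type) (frameD V) × CMAdelic (L : Type) (dW S) →* ℂˣ) (ν : CMAdelic (L : Type) (frameD V) →* ℂˣ)

/-- the S-side line representation of line `k` with the ν-TWISTED split on lines 0,1 and the default split on lines 2,3
(reducible wrapper of LAYER B's `lineRepOf`; `lineRepT … 2/3` are definitionally `lineRepD … 2/3`). -/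
abbrev lineRepT (k : Fin 4) :
    Representation ℂ (↥(regimeSubgroup L V.Hm) × ↥(NumberField.relNormOneIdeles (↥(maximalRealSubfield L)) L))
      (piSchwartzBruhat (↥(maximalRealSubfield L)) (Fin 3)) :=
  lineRepOf V S hGR hGR₀ hGR₁ hGR₂ hGR₃ (etaT₀ V S η ν) (etaT₁ V S η ν) (eta₂ V S η) (eta₃ V S η) k

/-- (Ported verbatim from the HodgeCMPerL package; no docstring in the source.) -/
theorem lineRepT_two : lineRepT V S hGR hGR₀ hGR₁ hGR₂ hGR₃ η ν 2 = lineRepD V S hGR hGR₀ hGR₁ hGR₂ hGR₃ η 2 := rfl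

/-- (Ported verbatim from the HodgeCMPerL package; no docstring in the source.) -/
theorem lineRepT_three : lineRepT V S hGR hGR₀ hGR₁ hGR₂ hGR₃ η ν 3 = lineRepD V S hGR hGR₀ hGR₁ hGR₂ hGR₃ η 3 := rfl

/-- at `ν = 1` the twisted line representations are the default ones. -/
theorem lineRepT_one (k : Fin 4) : lineRepT V S hGR hGR₀ hGR₁ hGR₂ hGR₃ η 1 k = lineRepD V S hGR hGR₀ hGR₁ hGR₂ hGR₃ η k := by
  rw [lineRepT, etaT₀_one, etaT₁_one]

/-- **(W-maj⁺) PROVED for the four twisted lines** [Weil1964 III n°41 Thm 6 p. 193]: from the framed pair majorants of the tree, the sign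
facts of `HermSpace3`, the definiteness `h₁W` of the plane at `ι₁`, and the continuity of `η` and `ν`. -/
theorem hasThetaMajorants_lineRepT (hηc : Continuous fun p => ((η p : ℂˣ) : ℂ)) (hνc : Continuous fun v => ((ν v : ℂˣ) : ℂ))
    (h₁W : (∀ j, 0 < (ι₁ (dW S j)).re) ∨ ∀ j, (ι₁ (dW S j)).re < 0) (k : Fin 4) :
    HasThetaMajorants fun (p : ↥(regimeSubgroup L V.Hm) × ↥(NumberField.relNormOneIdeles (↥(maximalRealSubfield L)) L))
      (φ : piSchwartzBruhat (↥(maximalRealSubfield L)) (Fin 3)) => lineRepT V S hGR hGR₀ hGR₁ hGR₂ hGR₃ η ν k p φ := by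
  fin_cases k
  · exact hasThetaMajorants_cmLineRepFin₀_framed_of_signs (L : Type) finProdFinEquiv e₁ (frameD V) (frameD_real V) (frameD_ne V)
      (dW S) (dW_real S) (dW_ne S) hGR hGR₀ hGR₁ (etaT₀ V S η ν) (frame_congr V) (regimeSubgroup L V.Hm) ι₁ (frameD_sign_ι₁' V) h₁W
      (frameD_sign_of_ne V) (continuous_etaT₀ V S η ν hηc hνc)
  · exact hasThetaMajorants_cmLineRepFin₁_framed_of_signs (L : Type) finProdFinEquiv e₁ (frameD V) (frameD_real V) (frameD_ne V)
      (dW S) (dW_real S) (dW_ne S) hGR hGR₀ hGR₁ (etaT₁ V S η ν) (frame_congr V) (regimeSubgroup L V.Hm) ι₁ (frameD_sign_ι₁' V) h₁W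
      (frameD_sign_of_ne V) (continuous_etaT₁ V S η ν hηc hνc)
  · exact hasThetaMajorants_lineRepD V S hGR hGR₀ hGR₁ hGR₂ hGR₃ η hηc h₁W 2
  · exact hasThetaMajorants_lineRepD V S hGR hGR₀ hGR₁ hGR₂ hGR₃ η hηc h₁W 3

/-- **(W-rat⁺) PROVED for the four twisted lines** [GelbartRogawski1991 §3.1 Remark p. 457 L4–13]: `lineRepT k (γ, t)` stabilises `Θ`
for `γ ∈ Γ = regimeRat` and `t ∈ U(1)(L⁺)`, from the rationality binders `hη` (W pin) and `hν`. -/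
theorem lineRepT_mem_thetaStabilizerEnd
    (hη : ∀ γU ∈ CMRat (L : Type) (frameD V), ∀ γ ∈ CMRat (L : Type) (dW S), η (γU, γ) = 1)
    (hν : ∀ γU ∈ CMRat (L : Type) (frameD V), ν γU = 1) (k : Fin 4) :
    ∀ γ ∈ (V.latticeModel printFact_unitaryCompact_holds).Γ, ∀ t ∈ NumberField.relNormOneRat (↥(maximalRealSubfield L)) L,
      lineRepT V S hGR hGR₀ hGR₁ hGR₂ hGR₃ η ν k (γ, t) ∈ thetaStabilizerEnd (↥(maximalRealSubfield L)) (Fin 3) := by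
  fin_cases k
  · exact forall_cmLineRepFin₀_framed_mem_thetaStabilizerEnd (L : Type) finProdFinEquiv e₁ (frameD V) (frameD_real V) (frameD_ne V)
      (dW S) (dW_real S) (dW_ne S) hGR hGR₀ hGR₁ (etaT₀ V S η ν) (frame_congr V) (regimeSubgroup L V.Hm)
      (V.latticeModel printFact_unitaryCompact_holds).Γ (fun γ hγ => (mem_regimeRat_iff γ).1 hγ)
      (fun v hv t ht => etaT₀_eq_one_of_rat V S η ν hη hν hv ht)
  · exact forall_cmLineRepFin₁_framed_mem_thetaStabilizerEnd (L : Type) finProdFinEquiv e₁ (frameD V) (frameD_real V) (frameD_ne V)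
      (dW S) (dW_real S) (dW_ne S) hGR hGR₀ hGR₁ (etaT₁ V S η ν) (frame_congr V) (regimeSubgroup L V.Hm)
      (V.latticeModel printFact_unitaryCompact_holds).Γ (fun γ hγ => (mem_regimeRat_iff γ).1 hγ)
      (fun v hv t ht => etaT₁_eq_one_of_rat V S η ν hη hν hv ht)
  · exact lineRepD_mem_thetaStabilizerEnd V S hGR hGR₀ hGR₁ hGR₂ hGR₃ η hη 2
  · exact lineRepD_mem_thetaStabilizerEnd V S hGR hGR₀ hGR₁ hGR₂ hGR₃ η hη 3

end Weil

/-! ## §S The S pin term with the twisted split -/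

section Term

variable (c : SeesawCtx L)
  (hGR : (cmSplittingDatum (L : Type) finProdFinEquiv (frameD V) (frameD_real V) (frameD_ne V) (dW c.D) (dW_real c.D)
    (dW_ne c.D)).CompatibleSplitting)
  (hGR₀ : (cmSplittingDatum (L : Type) (e₁) (frameD V) (frameD_real V) (frameD_ne V) (lineVec (L : Type) (dW c.D 0))
    (fun _ => dW_real c.D 0) (fun _ => dW_ne c.D 0)).CompatibleSplitting)
  (hGR₁ : (cmSplittingDatum (L : Type) (e₁) (frameD V) (frameD_real V) (frameD_ne V) (lineVec (L : Type) (dW c.D 1))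
    (fun _ => dW_real c.D 1) (fun _ => dW_ne c.D 1)).CompatibleSplitting)
  (hGR₂ : (cmSplittingDatum (L : Type) (e₁) (frameD V) (frameD_real V) (frameD_ne V) (lineVec (L : Type) (dW' c.D 0))
    (fun _ => dW'_real c.D 0) (fun _ => dW'_ne c.D 0)).CompatibleSplitting)
  (hGR₃ : (cmSplittingDatum (L : Type) (e₁) (frameD V) (frameD_real V) (frameD_ne V) (lineVec (L : Type) (dW' c.D 1))
    (fun _ => dW'_real c.D 1) (fun _ => dW'_ne c.D 1)).CompatibleSplitting)
  (η : CMAdelic (L : Type) (frameD V) × CMAdelic (L : Type) (dW c.D) →* ℂˣ)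
  (hη : ∀ γU ∈ CMRat (L : Type) (frameD V), ∀ γ ∈ CMRat (L : Type) (dW c.D), η (γU, γ) = 1)
  (hηc : Continuous fun p => ((η p : ℂˣ) : ℂ))
  (ν : CMAdelic (L : Type) (frameD V) →* ℂˣ)
  (hν : ∀ γU ∈ CMRat (L : Type) (frameD V), ν γU = 1)
  (hνc : Continuous fun v => ((ν v : ℂˣ) : ℂ))
  (h₁W : (∀ j, 0 < (ι₁ (dW c.D j)).re) ∨ ∀ j, (ι₁ (dW c.D j)).re < 0)
  (A : ∀ k : Fin 4, ArchLineInput V (lineRepT V c.D hGR hGR₀ hGR₁ hGR₂ hGR₃ η ν k))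

/-- **THE TWISTED S PIN TERM** `archSideOfT V c … : ThetaAdelicSide V c` — `(P k).ω := lineRepT k` on the nose (lines 0,1 twisted by
`ν`, lines 2,3 as in `archSideOf`), `(P k).ΓU := (V.latticeModel hP).Γ`, the archimedean component / away-factor / commutation / rational
splitting of #1097 with their finite-level companions of `ArchSideLevel`, both Weil hypotheses PROVED (§W); `A k` input. -/
def archSideOfT : ThetaAdelicSide V c where
  P k :=
    { ΓU := (V.latticeModel printFact_unitaryCompact_holds).Γ
      ω := lineRepT V c.D hGR hGR₀ hGR₁ hGR₂ hGR₃ η ν k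
      Φinf := (A k).Φinf
      x₀ := (A k).x₀
      hx₀ := (A k).hx₀
      w := (A k).w
      weight := (A k).weight
      majorants := hasThetaMajorants_lineRepT V c.D hGR hGR₀ hGR₁ hGR₂ hGR₃ η ν hηc hνc h₁W k
      theta_rat := lineRepT_mem_thetaStabilizerEnd V c.D hGR hGR₀ hGR₁ hGR₂ hGR₃ η ν hη hν k }
  hΓU _ := rfl
  ιinf := archInfOf V
  Gfin := archFinOf V
  comm_fin := commute_archFinOf_archInfOf V
  rat_split := rat_split_archInfOf V
  fin_mem_Gfin := inv_finAdelic_mem_archFinOf V      -- (L3b), `HodgeCM/Model/ArchSideLevel.lean`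
  rat_split_level := rat_split_level_archInfOf V     -- (L3),  `HodgeCM/Model/ArchSideLevel.lean`

/-! ### read-backs (all `rfl`) -/

/-- (Ported verbatim from the HodgeCMPerL package; no docstring in the source.) -/
@[simp] theorem archSideOfT_P_ω (k : Fin 4) :
    ((archSideOfT V c hGR hGR₀ hGR₁ hGR₂ hGR₃ η hη hηc ν hν hνc h₁W A).P k).ω =
      lineRepOf V c.D hGR hGR₀ hGR₁ hGR₂ hGR₃ (etaT₀ V c.D η ν) (etaT₁ V c.D η ν) (eta₂ V c.D η) (eta₃ V c.D η) k := rfl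

/-- lines 2,3 of the twisted term are those of `archSideOf` with the same test data, definitionally. -/
theorem archSideOfT_P_ω_two :
    ((archSideOfT V c hGR hGR₀ hGR₁ hGR₂ hGR₃ η hη hηc ν hν hνc h₁W A).P 2).ω = lineRepD V c.D hGR hGR₀ hGR₁ hGR₂ hGR₃ η 2 := rfl

/-- (Ported verbatim from the HodgeCMPerL package; no docstring in the source.) -/
theorem archSideOfT_P_ω_three :
    ((archSideOfT V c hGR hGR₀ hGR₁ hGR₂ hGR₃ η hη hηc ν hν hνc h₁W A).P 3).ω = lineRepD V c.D hGR hGR₀ hGR₁ hGR₂ hGR₃ η 3 := rfl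

/-- (Ported verbatim from the HodgeCMPerL package; no docstring in the source.) -/
@[simp] theorem archSideOfT_P_ΓU (k : Fin 4) :
    ((archSideOfT V c hGR hGR₀ hGR₁ hGR₂ hGR₃ η hη hηc ν hν hνc h₁W A).P k).ΓU = (V.latticeModel printFact_unitaryCompact_holds).Γ := rfl

/-- (Ported verbatim from the HodgeCMPerL package; no docstring in the source.) -/
@[simp] theorem archSideOfT_P_Φinf (k : Fin 4) :
    ((archSideOfT V c hGR hGR₀ hGR₁ hGR₂ hGR₃ η hη hηc ν hν hνc h₁W A).P k).Φinf = (A k).Φinf := rfl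

/-- (Ported verbatim from the HodgeCMPerL package; no docstring in the source.) -/
@[simp] theorem archSideOfT_P_x₀ (k : Fin 4) :
    ((archSideOfT V c hGR hGR₀ hGR₁ hGR₂ hGR₃ η hη hηc ν hν hνc h₁W A).P k).x₀ = (A k).x₀ := rfl

/-- (Ported verbatim from the HodgeCMPerL package; no docstring in the source.) -/
@[simp] theorem archSideOfT_P_w (k : Fin 4) :
    ((archSideOfT V c hGR hGR₀ hGR₁ hGR₂ hGR₃ η hη hηc ν hν hνc h₁W A).P k).w = (A k).w := rfl

/-- (Ported verbatim from the HodgeCMPerL package; no docstring in the source.) -/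
@[simp] theorem archSideOfT_ιinf : (archSideOfT V c hGR hGR₀ hGR₁ hGR₂ hGR₃ η hη hηc ν hν hνc h₁W A).ιinf = archInfOf V := rfl

/-- (Ported verbatim from the HodgeCMPerL package; no docstring in the source.) -/
@[simp] theorem archSideOfT_Gfin : (archSideOfT V c hGR hGR₀ hGR₁ hGR₂ hGR₃ η hη hηc ν hν hνc h₁W A).Gfin = archFinOf V := rfl

/-- (L3b) AT THE TERM: `regimeEquiv … (e.symm (1, k_f)) ∈ (archSideOfT V c …).Gfin` for every finite-adelic `k_f`. -/
theorem regimeEquiv_prodSymm_one_mem_archSideOfT_Gfin (hV : IsAnisotropic L V.Hm)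
    (kf : ↥(UnitaryGroup.finAdelic (↥(maximalRealSubfield L)) (L : Type) (IsCMField.complexConj L) 3 V.Hm)) :
    (Adelic.regimeEquiv L V.Hm hV ((UnitaryGroup.cmAdelicProdEquiv (L : Type) 3 V.Hm).symm (1, kf)) :
        (V.latticeModel printFact_unitaryCompact_holds).G) ∈
      (archSideOfT V c hGR hGR₀ hGR₁ hGR₂ hGR₃ η hη hηc ν hν hνc h₁W A).Gfin :=
  regimeEquiv_prodSymm_one_mem_archFinOf V hV kf

/-- D-1′ `hι` AT THE TERM (binder-1 `Real34PinJunctions.hι`, verbatim right-hand side). -/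
theorem archSideOfT_ιinf_apply (hV : IsAnisotropic L V.Hm) (u : U21) :
    (archSideOfT V c hGR hGR₀ hGR₁ hGR₂ hGR₃ η hη hηc ν hν hνc h₁W A).ιinf u =
      Adelic.regimeEquiv L V.Hm hV
        (UnitaryGroup.archSectionU21CM (L : Type) ι₁ V.Hm V.sylvesterFrame (sylvesterFrame_J V) u) :=
  archInfOf_eq_regimeEquiv V hV u

/-! ### the binder-1 junctions, SPECIALISED to the twisted term (no η-split hypothesis left) -/

/-- **`op`** of `SeesawCore.ofOp` for the twisted term: LAYER B `op_lineRepOf` with `hη01 := etaT_torus01`. -/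
theorem op_archSideOfT (g : ↥(regimeSubgroup L V.Hm)) (t : SeesawTorus (↥(maximalRealSubfield L)) L)
    (φ₁ φ₂ : piSchwartzBruhat (↥(maximalRealSubfield L)) (Fin 3)) :
    cmPairRepTwist (L : Type) finProdFinEquiv (frameD V) (frameD_real V) (frameD_ne V) (dW c.D) (dW_real c.D) (dW_ne c.D) hGR η
        ((cmFrameEquiv (L : Type) (frameG V) V.Hm (frameD V) (frame_congr V)) (g : ↥(HodgeCM.Adelic.adelicUnitaryGroup (L : Type) V.Hm)),
          cmAdelicEquiv (L : Type) 2 (Matrix.diagonal (dW c.D)) (c.D.jT₁₂ t)) (tau12 V c.D φ₁ φ₂) =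
      tau12 V c.D (((archSideOfT V c hGR hGR₀ hGR₁ hGR₂ hGR₃ η hη hηc ν hν hνc h₁W A).P 0).ω (g, SeesawTorus.fst _ L t) φ₁)
        (((archSideOfT V c hGR hGR₀ hGR₁ hGR₂ hGR₃ η hη hηc ν hν hνc h₁W A).P 1).ω (g, SeesawTorus.snd _ L t) φ₂) :=
  op_lineRepOf V c.D hGR hGR₀ hGR₁ hGR₂ hGR₃ η _ _ _ _ g t (etaT_torus01 V c.D η ν) φ₁ φ₂

/-- **`seesaw`** of `SeesawHyp34` for the twisted term: LAYER B `seesaw34_lineRepOf` with `hη23 := eta_torus23` (lines 2,3 untwisted). -/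
theorem seesaw34_archSideOfT (g : ↥(regimeSubgroup L V.Hm)) (t : SeesawTorus (↥(maximalRealSubfield L)) L)
    (φ₂ φ₃ : piSchwartzBruhat (↥(maximalRealSubfield L)) (Fin 3)) :
    thetaDistLM (↥(maximalRealSubfield L)) (Fin 6)
        (cmPairRepTwist (L : Type) finProdFinEquiv (frameD V) (frameD_real V) (frameD_ne V) (dW c.D) (dW_real c.D) (dW_ne c.D) hGR η
          ((cmFrameEquiv (L : Type) (frameG V) V.Hm (frameD V) (frame_congr V)) (g : ↥(HodgeCM.Adelic.adelicUnitaryGroup (L : Type) V.Hm)),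
            cmAdelicEquiv (L : Type) 2 (Matrix.diagonal (dW c.D)) (c.D.jT₃₄ t)) (tau34 V c.D φ₂ φ₃)) =
      thetaDistLM (↥(maximalRealSubfield L)) (Fin 3)
          (((archSideOfT V c hGR hGR₀ hGR₁ hGR₂ hGR₃ η hη hηc ν hν hνc h₁W A).P 2).ω (g, SeesawTorus.fst _ L t) φ₂) *
        thetaDistLM (↥(maximalRealSubfield L)) (Fin 3)
          (((archSideOfT V c hGR hGR₀ hGR₁ hGR₂ hGR₃ η hη hηc ν hν hνc h₁W A).P 3).ω (g, SeesawTorus.snd _ L t) φ₃) :=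
  seesaw34_lineRepOf V c.D hGR hGR₀ hGR₁ hGR₂ hGR₃ η _ _ _ _ g t (eta_torus23 V c.D η) φ₂ φ₃

/-- the operator-level version for lines `2,3`: LAYER B `op34_lineRepOf` with `hη23 := eta_torus23`. -/
theorem op34_archSideOfT (g : ↥(regimeSubgroup L V.Hm)) (t : SeesawTorus (↥(maximalRealSubfield L)) L)
    (φ₂ φ₃ : piSchwartzBruhat (↥(maximalRealSubfield L)) (Fin 3)) :
    cmPairRepTwist (L : Type) finProdFinEquiv (frameD V) (frameD_real V) (frameD_ne V) (dW c.D) (dW_real c.D) (dW_ne c.D) hGR η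
        ((cmFrameEquiv (L : Type) (frameG V) V.Hm (frameD V) (frame_congr V)) (g : ↥(HodgeCM.Adelic.adelicUnitaryGroup (L : Type) V.Hm)),
          cmAdelicEquiv (L : Type) 2 (Matrix.diagonal (dW c.D)) (c.D.jT₃₄ t)) (tau34 V c.D φ₂ φ₃) =
      tau34 V c.D (((archSideOfT V c hGR hGR₀ hGR₁ hGR₂ hGR₃ η hη hηc ν hν hνc h₁W A).P 2).ω (g, SeesawTorus.fst _ L t) φ₂)
        (((archSideOfT V c hGR hGR₀ hGR₁ hGR₂ hGR₃ η hη hηc ν hν hνc h₁W A).P 3).ω (g, SeesawTorus.snd _ L t) φ₃) :=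
  op34_lineRepOf V c.D hGR hGR₀ hGR₁ hGR₂ hGR₃ η _ _ _ _ g t (eta_torus23 V c.D η) φ₂ φ₃

end Term

end ArchSideTerm

end HodgeCM.Model

end
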